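import Summits.HodgeConjecture.CorCM.HypDel.M1primeOfFUPart1   -- E-FU part 1

/-!
# M1′ from (F) and (U) — E-FU PART 3 of 7 (+ HEAD `M1primeOfFU`): 
§ 5 — W4 CLOSER (B-p07 g9) `stubW4`; § 6 — (T2) `markedByTranslateRight` (B-p15 g6); `translateRightT`

Cell hodgecm-mathlib, rung 0 of the Mumford line under `HDel` (item `stmt-HodgeConjecture-24835`).  The E-FU text proves
`deligne1971_siegelModuliOnPoints` (M1′ = [Deligne 1971, 4.16–4.21 on points]) as a THEOREM of the two finer printed facts
(F) `lan2013_siegelFineModuliScheme` [Lan 2013, Thm. 1.4.1.11 + Cor. 7.2.3.9] and (U) `siegelModuli_complexUniformisation`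
[MFK94 App. 7A; Deligne 1971, 4.12–4.21; Milne 2005 Thm. 6.11]; it is split into a chain of part files only because of the
400-line cap on proof-bearing `Summits/` files (B-plan1 R22, director s96).  The composition and `theorem M1prime_of_F_U` live in
the HEAD file `Summits/HodgeConjecture/CorCM/HypDel/M1primeOfFU.lean`; provenance of every § is kept in its banner below and in
HOME `B-plan/lines/m1prime/M1primeOfFU.skeleton.md`.  This part does NOT depend on (F)/(U).
HC_CM is proved only modulo the 7 printed citations until rung 0 closes.
-/

universe u   -- was declared inside the dropped D1 paste
open CategoryTheory CategoryTheory.Limits AlgebraicGeometry MonoidalCategory   -- was a TOP-LEVEL `open` of the dropped D1 paste (and of (M)); the pasted (F)/(U)/partC/§§ rely on it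

/-! ═══════════════════════════════════════════════════════════════════════════════════════════════════════════════════
# § W4 — CLOSER (B-p07 g9, pen of `stub_W4`): `StubW4` (skeleton v0.4 text of record (r1)) CLOSED OUTRIGHT, (F)/(U) unused.
Contents: PASTE of P31 `LevelStructureTwist` (B-typ02 D3 ed.-2 body, by-import bytes; bound `γ` renamed `gam` because `γ` is a
notation in this cone) · PASTE of (N) `LevelStructure.IsBaseChangeVia.twist` (B-p04 g13 0b88ed07; its (c4) prerequisites are § 2
(closer-§ provenance and fold history: HOME `B-plan/lines/m1prime/M1primeOfFU.skeleton.md` + the by-import twin editions.) -/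

/- § 5 BY IMPORT (B-p07 g9 probe `B-provers/B-p07/StubW4.section5.byimport-probe.B-p07g9.lean` 50b2018ab53494e7 ll. 72–197 VERBATIM; his
   by-paste SECTIONS A/B and the P31/(N) pastes are now ★ S1 p684100 `SymplecticLiftTwist` / ★ S2 p684063 `SiegelPrincipalLevelSimilitudeTower` /
   ★ P31 / ★ (N), imported above; wrapped in a `section` so his root-level `open`s scope to § 5). -/

noncomputable section StubW4ByImport

open CategoryTheory CategoryTheory.Limits AlgebraicGeometry MonoidalCategory Matrix

namespace Literature.AlgebraicGeometry.AbelianSchemes.PolarizedAbelianSchemeWithLevel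

open CategoryTheory AlgebraicGeometry Matrix Literature.AlgebraicGeometry.Motives

variable {g N : ℕ} {δ : Fin g → ℕ}

/-- **Twisting commutes with pull-back**: if `P′` over `T` is the pull-back of `P` over `S` along `(f, G, Ĝ)`, then so is
`P′` with its level twisted by `Γ_N` of `P` with its level twisted by `Γ_N` (the level clause is B-p04's
`LevelStructure.IsBaseChangeVia.twist`; the other four clauses are untouched). [cite: MumfordFogartyKirwan1994, Ch. 7 §2 Definition 7.3 (p. 130)] -/
theorem IsBaseChangeVia.twist_level {S T : Scheme.{u}} {P' : PolarizedAbelianSchemeWithLevel g N δ T}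
    {P : PolarizedAbelianSchemeWithLevel g N δ S} [IsCommMonObj P'.A.X] [IsCommMonObj P.A.X] [NeZero N]
    {f : T ⟶ S} {G : P'.A.X.left ⟶ P.A.X.left} {Ĝ : P'.D.hat.X.left ⟶ P.D.hat.X.left}
    (h : P'.IsBaseChangeVia P f G Ĝ) (ΓN : GL (Fin g ⊕ Fin g) (ZMod N))
    (hs' : (P'.level.twist ΓN).IsSymplecticLiftable P'.pol δ) (hs : (P.level.twist ΓN).IsSymplecticLiftable P.pol δ) :
    ({ P' with level := P'.level.twist ΓN, symplectic := hs' } : PolarizedAbelianSchemeWithLevel g N δ T).IsBaseChangeVia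
      { P with level := P.level.twist ΓN, symplectic := hs } f G Ĝ :=
  ⟨h.1.twist ΓN, h.2.1, h.2.2.1, h.2.2.2⟩

end Literature.AlgebraicGeometry.AbelianSchemes.PolarizedAbelianSchemeWithLevel

/- ═════ B-p07 (g9) — W4 SECTION D: twisted markings and the Hecke operator at the carrier ═════ -/

namespace Summit.HodgeConjecture.CorCM.HypDel.M1primeOfFU

open CategoryTheory AlgebraicGeometry Matrix NumberField IsDedekindDomain Literature.NumberTheory.Adeles
open Literature.AlgebraicGeometry.AbelianSchemes Literature.AlgebraicGeometry.Motives
open Literature.AlgebraicGeometry.ModuliOfAbelianVarieties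

variable {g N : ℕ} {δ : Fin g → ℕ}

/-- **Twisting a `(J, a)`-marked triple by `γ ∈ K_δ(1)` gives a `(J, aγ)`-marked triple**: the same abelian variety,
polarisation and ample witness, the marking transported along `Λ_{aγ} = Λ_a` (★ T1′
`IsLatticeBasis.mul_of_mem_principalLevelSubgroup_one`, same torsion parametrisation `r`), and the symplectic lift
`lift_M ∘ γ̄_M` of the twisted level structure (§A); the tower clause for `(aγ)⁻¹ = γ⁻¹ a⁻¹` follows from the one for
`a⁻¹` at the relabelled torsion index `γ̄_M x` (`adelicCongr_val_div_of_entries_residue`).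
[cite: Milne2005ShimuraVarieties, §6 Thm. 6.11 p. 74 and (63) p. 116] [cite: Deligne1971TravauxShimura, 4.12 (b) p. 149] -/
theorem MarkedBy.twist [NeZero N] {γk : gspFinAdelic δ} (hγ : γk ∈ principalLevelSubgroup δ 1)
    (Γ : ∀ M : ℕ, GL (Fin g ⊕ Fin g) (ZMod M)) (ν : ∀ M : ℕ, (ZMod M)ˣ)
    (hent : ∀ (M : ℕ) [NeZero M] (i j : Fin g ⊕ Fin g)
      (h : ((γk : GL (Fin g ⊕ Fin g) finAdeleQ) : Matrix (Fin g ⊕ Fin g) (Fin g ⊕ Fin g) finAdeleQ) i j ∈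
        FiniteAdeleRing.integralAdeles (𝓞 ℚ) ℚ),
      (Γ M : Matrix (Fin g ⊕ Fin g) (Fin g ⊕ Fin g) (ZMod M)) i j = integralAdeleResidue M ⟨_, h⟩)
    (hΓ : ∀ ⦃M : ℕ⦄ (k : ℕ), M ≠ 0 → k ≠ 0 → ∀ i j,
      ZMod.castHom (Dvd.intro_left k rfl) (ZMod M)
          ((Γ (k * M) : Matrix (Fin g ⊕ Fin g) (Fin g ⊕ Fin g) (ZMod (k * M))) i j) =
        (Γ M : Matrix (Fin g ⊕ Fin g) (Fin g ⊕ Fin g) (ZMod M)) i j)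
    (hν : ∀ ⦃M : ℕ⦄ (k : ℕ), M ≠ 0 → k ≠ 0 →
      ZMod.castHom (Dvd.intro_left k rfl) (ZMod M) ((ν (k * M) : ZMod (k * M))) = (ν M : ZMod M))
    (hsim : ∀ ⦃M : ℕ⦄, M ≠ 0 → ∀ x y : Fin g ⊕ Fin g → ZMod M,
      AbelianSchemeOver.typeFormMod δ M ((Γ M : Matrix (Fin g ⊕ Fin g) (Fin g ⊕ Fin g) (ZMod M)) *ᵥ x)
          ((Γ M : Matrix (Fin g ⊕ Fin g) (Fin g ⊕ Fin g) (ZMod M)) *ᵥ y) =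
        (ν M : ZMod M) * AbelianSchemeOver.typeFormMod δ M x y)
    {J : C0pm δ} {a : gspFinAdelic δ} {P' : PolarizedAbelianSchemeWithLevel g N δ (specOver ℚ ℂ).left}
    [IsCommMonObj P'.A.X] (hs' : (P'.level.twist (Γ N)).IsSymplecticLiftable P'.pol δ) (hP : MarkedBy J a P') :
    MarkedBy J (a * γk) { P' with level := P'.level.twist (Γ N), symplectic := hs' } := by
  obtain ⟨m, Θ, Λ, hΘ, hlam, hcl⟩ := hP
  obtain ⟨Λ', hΛ'⟩ := Λ.exists_twist Γ ν (fun M k _ hM0 hk => hΓ k hM0 hk) (fun M k _ hM0 hk => hν k hM0 hk)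
    (fun M _ hM0 => hsim hM0)
  refine ⟨{ m with γ_isLatticeBasis := m.γ_isLatticeBasis.mul_of_mem_principalLevelSubgroup_one hγ },
    Θ, Λ', hΘ, hlam, ?_⟩
  intro M hNM hM0 x v hcongr
  haveI : NeZero M := ⟨hM0⟩
  rw [hΛ' M x]
  refine hcl hNM hM0 ((Γ M : Matrix (Fin g ⊕ Fin g) (Fin g ⊕ Fin g) (ZMod M)) *ᵥ x) v ?_
  -- `(aγ)⁻¹ v ≡ x/M` ⟹ `a⁻¹ v ≡ γ (x/M) ≡ (γ̄_M x)/M`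
  have hint : ∀ i j, ((γk : GL (Fin g ⊕ Fin g) finAdeleQ) : Matrix (Fin g ⊕ Fin g) (Fin g ⊕ Fin g) finAdeleQ) i j ∈
      FiniteAdeleRing.integralAdeles (𝓞 ℚ) ℚ := fun i j =>
    isIntegral_of_isCongOne_one (A := ((γk : GL (Fin g ⊕ Fin g) finAdeleQ) :
      Matrix (Fin g ⊕ Fin g) (Fin g ⊕ Fin g) finAdeleQ)) ((mem_principalLevelSubgroup_iff δ).1 hγ).1 i j
  have h1 := hcongr.mul_left (u := (γk : GL (Fin g ⊕ Fin g) finAdeleQ)) hint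
  rw [Subgroup.coe_inv, Subgroup.coe_mul, _root_.mul_inv_rev, mul_inv_cancel_left, mul_one] at h1
  rw [Subgroup.coe_inv]
  exact h1.trans (adelicCongr_val_div_of_entries_residue hγ (Γ M : Matrix (Fin g ⊕ Fin g) (Fin g ⊕ Fin g) (ZMod M))
    (fun i j h => hent M i j h) x)

/-- **W4 under the commutativity binders (repair (r1) of `StubW4`)** — integral Hecke operators AT THE CARRIER: for a
fine moduli scheme `𝓜` at level `N ≥ 3` whose universal abelian scheme is a COMMUTATIVE group object and
`γ ∈ K_δ(1) = GSp_δ(ẑ)`, the `ℚ`-endomorphism `T_γ := classifyingMap (univ · γ̄)` of `𝓜.M` (MFK's moduli property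
applied to the universal triple with its level structure twisted by the reduction `γ̄_N` of `γ`, §B/§C) sends the
classifying point of every `(J, a)`-marked triple (with commutative group object) to the classifying point of the
`(J, aγ)`-marked twisted triple (`MarkedBy.twist`), by the naturality `classifyingMap_comp`.
[cite: MumfordFogartyKirwan1994, App. 7A pp. 235–236] [cite: Milne2005ShimuraVarieties, §13 Thm. 13.6 p. 117, §6 Thm. 6.11 p. 74]
[cite: Deligne1971TravauxShimura, 4.17 p. 150] -/
theorem stubW4_of_comm (g N : ℕ) (δ : Fin g → ℕ) (hg : 0 < g) (hδ : IsPolarizationType δ) (hN : 3 ≤ N)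
    (𝓜 : SiegelFineModuliScheme g N δ) [IsCommMonObj 𝓜.univ.A.X] (γ : gspFinAdelic δ)
    (hγ : γ ∈ principalLevelSubgroup δ 1) :
    haveI : IsLocallyNoetherian (specOver ℚ ℂ).left :=
      inferInstanceAs (IsLocallyNoetherian (Spec (CommRingCat.of ℂ)))
    ∃ Tq : 𝓜.M ⟶ 𝓜.M, ∀ (J : C0pm δ) (a : gspFinAdelic δ)
      (P' : PolarizedAbelianSchemeWithLevel g N δ (specOver ℚ ℂ).left) [IsCommMonObj P'.A.X], MarkedBy J a P' →
        ∃ P'' : PolarizedAbelianSchemeWithLevel g N δ (specOver ℚ ℂ).left, MarkedBy J (a * γ) P'' ∧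
          𝓜.classifyingMap (specOver ℚ ℂ) P' ≫ Tq = 𝓜.classifyingMap (specOver ℚ ℂ) P'' := by
  haveI : IsLocallyNoetherian (specOver ℚ ℂ).left :=
    inferInstanceAs (IsLocallyNoetherian (Spec (CommRingCat.of ℂ)))
  haveI : NeZero N := ⟨by omega⟩
  haveI := 𝓜.isLocallyNoetherian
  obtain ⟨Γ, ν, hent, hΓ, hν, hsim⟩ := exists_similitudeTower δ hδ hg hγ
  -- the universal triple with its level twisted by `γ̄_N`, and its classifying map `T_γ`
  let U : PolarizedAbelianSchemeWithLevel g N δ 𝓜.M.left :=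
    { 𝓜.univ with
      level := 𝓜.univ.level.twist (Γ N)
      symplectic := 𝓜.univ.symplectic.twist Γ ν hΓ hν hsim }
  refine ⟨𝓜.classifyingMap 𝓜.M U, fun J a P' _ hP => ?_⟩
  let P'' : PolarizedAbelianSchemeWithLevel g N δ (specOver ℚ ℂ).left :=
    { P' with
      level := P'.level.twist (Γ N)
      symplectic := P'.symplectic.twist Γ ν hΓ hν hsim }
  refine ⟨P'', MarkedBy.twist hγ Γ ν (fun M _ i j h => hent M i j h) hΓ hν hsim _ hP, ?_⟩
  obtain ⟨G, Ĝ, hbc⟩ := 𝓜.exists_isBaseChangeVia_classifyingMap (specOver ℚ ℂ) P'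
  exact 𝓜.classifyingMap_comp (𝓜.classifyingMap (specOver ℚ ℂ) P') U P''
    (PolarizedAbelianSchemeWithLevel.IsBaseChangeVia.twist_level hbc (Γ N) _ _)

end Summit.HodgeConjecture.CorCM.HypDel.M1primeOfFU

namespace Summit.HodgeConjecture.CorCM.HypDel.M1primeOfFU

/-- **`StubW4` — integral Hecke operators at the carrier — CLOSED OUTRIGHT** (skeleton v0.4 text of record (r1), with the
two [MFK94 Ch. 6 §1 Cor. 6.5] commutativity binders): `stubW4_of_comm` re-packaged; (F) and (U) are not used.
[cite: MumfordFogartyKirwan1994, App. 7A pp. 235–236] [cite: Milne2005ShimuraVarieties, §6 Thm. 6.11 p. 74] -/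
theorem stubW4 : (∀ (g N : ℕ) (δ : Fin g → ℕ), StubW4 g N δ) := by
  intro g N δ hg hδ hN 𝓜 _ γ hγ
  exact stubW4_of_comm g N δ hg hδ hN 𝓜 γ hγ

end Summit.HodgeConjecture.CorCM.HypDel.M1primeOfFU

namespace Summit.HodgeConjecture.CorCM.HypDel.M1primeOfFU

end Summit.HodgeConjecture.CorCM.HypDel.M1primeOfFU

end StubW4ByImport

/-! # (T2) — RE-POINTED BY IMPORT (B-p15 g6 certificate over B-p11's § 7 v3 base 06cf80c7 = twin v9 + 2 imports): §A = ★ p685711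
`Literature.AlgebraicGeometry.AbelianSchemes.SymplecticLiftReindex`, §B + §C's two adelic lemmas = ★ p686253
`Literature.AlgebraicGeometry.ModuliOfAbelianVarieties.SiegelReindexTower` (same FQNs and signatures as the pasted text they replace,
06cf80c7 ll. 2665–3224); the Summit-side (T2) leaf below (06cf80c7 ll. 3226–3277) is VERBATIM. -/

noncomputable section

namespace Summit.HodgeConjecture.CorCM.HypDel.M1primeOfFU

open CategoryTheory AlgebraicGeometry
open Literature.AlgebraicGeometry
open Literature.AlgebraicGeometry.Motives (specOver)
open Literature.AlgebraicGeometry.AbelianSchemes (PolarizedAbelianSchemeWithLevel)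
open Literature.AlgebraicGeometry.ModuliOfAbelianVarieties
open scoped Matrix

/-- **(T2) `MarkedBy.translateRight` — RIGHT TRANSPORT of a marking along `K_δ(N)`**: a triple over `Spec ℂ` marked by
`(J, b)` is marked by `(J, b·k)` for every `k ∈ K_δ(N)` — SAME `Θ`, the T1′ marking RE-BASED (`Λ_{bk} = Λ_b`, ★
`IsLatticeBasis.mul_of_mem_principalLevelSubgroup_one`, same `γ, Ψ, toFun`, so `r` is unchanged), and the symplectic tower
RE-INDEXED by `k` (`SymplecticLift.reindex` with the tower `reindexTowerOf`: `lift′_M = lift_M ∘ (k mod M)`, `ζ′ = ζ^{ν(k)}`);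
the marking clause transports by `adelicCongr_inv_reindex_of_adelicCongr_mul_inv`.  (`N = 0`: `K_δ(0) = 1`.)
[cite: Milne2005ShimuraVarieties, §6 Thm. 6.11 p. 74 and proof p. 75, §5 Lemma 5.13 p. 57]
[cite: Lan2013PELCompactifications, §1.3.6 Def. 1.3.6.2 (p. 80) and Lemma 1.3.6.5 (p. 81)] [cite: Deligne1971TravauxShimura, 4.16 p. 150] -/
theorem MarkedBy.translateRight {g N : ℕ} {δ : Fin g → ℕ} {k : gspFinAdelic δ} (hk : k ∈ principalLevelSubgroup δ N)
    {J : C0pm δ} {b : gspFinAdelic δ} {P' : PolarizedAbelianSchemeWithLevel g N δ (specOver ℚ ℂ).left}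
    (h : MarkedBy J b P') : MarkedBy J (b * k) P' := by
  by_cases hN : N = 0
  · subst hN
    rw [eq_one_of_mem_principalLevelSubgroup_zero hk, mul_one]
    exact h
  obtain ⟨m, Θ, Λ, hΘ, hlam, hcl⟩ := h
  have hk1 : k ∈ principalLevelSubgroup δ 1 := principalLevelSubgroup_anti δ (one_dvd N) hk
  refine ⟨{ m with γ_isLatticeBasis := m.γ_isLatticeBasis.mul_of_mem_principalLevelSubgroup_one hk1 }, Θ,
    Λ.reindex (reindexTowerOf hN hk), hΘ, hlam, ?_⟩
  intro M hNM hM₀ x v hv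
  rw [AbelianSchemes.AbelianSchemeOver.LevelStructure.SymplecticLift.reindex_lift_ofAdd]
  exact hcl hNM hM₀ _ v (adelicCongr_inv_reindex_of_adelicCongr_mul_inv hN hk hM₀ hv)

/-- **(T2) CLOSED**: the wlayer's leaf `MarkedByTranslateRight g N δ` (:2659, VERBATIM) holds for all `g, N, δ`.
[cite: Milne2005ShimuraVarieties, §6 Thm. 6.11 p. 74 and proof p. 75] [cite: Lan2013PELCompactifications, §1.3.6 Lemma 1.3.6.5 (p. 81)] -/
theorem markedByTranslateRight (g N : ℕ) (δ : Fin g → ℕ) : MarkedByTranslateRight g N δ :=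
  fun _ hk _ _ _ h => MarkedBy.translateRight hk h

end Summit.HodgeConjecture.CorCM.HypDel.M1primeOfFU

end

/-! ## (T2) in the skeleton’s shape — relocated from the running head -/

namespace Summit.HodgeConjecture.CorCM.HypDel.M1primeOfFU

open Literature.AlgebraicGeometry.ModuliOfAbelianVarieties

/-- Binder shuffle: B-p11's (T2) shape `∀ g N δ, MarkedByTranslateRight g N δ` gives B-p05's `TranslateRightT`. JUNCTION (problem-side composition, not a printed claim; locator = the printed statement it assembles)
[cite: Milne2005ShimuraVarieties, §6 p. 75] -/
theorem translateRightT_of_markedByTranslateRight (T2 : ∀ g N δ, MarkedByTranslateRight g N δ) : (∀ {g N : ℕ} {δ : Fin g → ℕ}, TranslateRightT g N δ) :=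
  fun {g N δ J a P' k} hk h => T2 g N δ k hk J a P' h

/-- (T2) of record, closed (B-p15 § 6). JUNCTION (problem-side composition, not a printed claim; locator = the printed statement it assembles)
[cite: Milne2005ShimuraVarieties, §6 p. 75] [cite: Deligne1971TravauxShimura, 4.12 (b) p. 149] -/
theorem translateRightT : (∀ {g N : ℕ} {δ : Fin g → ℕ}, TranslateRightT g N δ) :=
  translateRightT_of_markedByTranslateRight markedByTranslateRight

end Summit.HodgeConjecture.CorCM.HypDel.M1primeOfFU
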